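import Summits.KontsevichZagierPeriods.KontsevichZagierPeriods.Theorems.GammaHodgeSector.Negative.LoadBearing

/-!
# `GammaHodgeSector` (stmt-KontsevichZagierPeriods-3742) — negative side VI (tool): a FINITE form
of the Hodge-type test

Landed copy of the `FiniteTest` section of §7 of `Cruxes/GammaHodgeSector/Disproof.lean`: the test
of the crux quantifies over all units `u ≥ 1`; it is periodic in `u` modulo any common multiple
`D` of the denominators of the `x_j, y_j, x_j + y_j` (and primed) — `hodgeSum_add_mul`,
`coprimeDen_add_mul` — hence equivalent to the test over `u ∈ [1, D]` (`hodgeCondition_iff_le`),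
which `decide +kernel` settles on concrete data (e.g. the triplication data `(1/9,5/9), (4/9,7/9)`
with `D = 9`, `k = 1`, in the work file). Needed by anyone instantiating the crux.
-/

noncomputable section

open MeasureTheory Set
open scoped BigOperators

namespace Summit.KontsevichZagierPeriods.GammaHodgeSectorNegative

open Literature.NumberTheory.Transcendental
open Literature.NumberTheory.Transcendental.KZ

section FiniteTest

/-- Periodicity of the test sum: `hodgeSum x y (u + D·t) = hodgeSum x y u` when every
`den x_j`, `den y_j`, `den (x_j + y_j)` divides `D`. [folklore] -/
theorem hodgeSum_add_mul {N : ℕ} {x y : Fin N → ℚ} {D : ℕ} (hx : ∀ j, (x j).den ∣ D)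
    (hy : ∀ j, (y j).den ∣ D) (hxy : ∀ j, (x j + y j).den ∣ D) (u t : ℕ) :
    hodgeSum x y (u + D * t) = hodgeSum x y u := by
  have key : ∀ q : ℚ, q.den ∣ D → Int.fract (((u + D * t : ℕ) : ℚ) * q) = Int.fract ((u : ℚ) * q) := by
    intro q hq
    obtain ⟨e, he⟩ := hq
    have hDq : (D : ℚ) * q = (e : ℚ) * (q.num : ℚ) := by
      have hnum : q * q.den = q.num := Rat.mul_den_eq_num q
      rw [he]
      push_cast
      linear_combination (e : ℚ) * hnum
    have : ((u + D * t : ℕ) : ℚ) * q = (u : ℚ) * q + ((t * e * q.num : ℤ) : ℚ) := by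
      push_cast
      linear_combination (t : ℚ) * hDq
    rw [this, Int.fract_add_intCast]
  unfold hodgeSum
  refine Finset.sum_congr rfl fun j _ => ?_
  rw [key _ (hx j), key _ (hy j), key _ (hxy j)]

/-- Periodicity of the coprimality side condition. [folklore] -/
theorem coprimeDen_add_mul {N : ℕ} {x y : Fin N → ℚ} {D : ℕ} (hx : ∀ j, (x j).den ∣ D)
    (hy : ∀ j, (y j).den ∣ D) (u t : ℕ) : CoprimeDen x y (u + D * t) ↔ CoprimeDen x y u := by
  have key : ∀ d : ℕ, d ∣ D → (Nat.Coprime (u + D * t) d ↔ Nat.Coprime u d) := by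
    intro d hd
    obtain ⟨e, rfl⟩ := hd
    rw [show u + d * e * t = u + (e * t) * d by ring]
    exact Nat.coprime_add_mul_right_left u d (e * t)
  unfold CoprimeDen
  exact forall_congr' fun j => and_congr (key _ (hx j)) (key _ (hy j))

/-- `CoprimeDen` is decidable (for `decide` on concrete data). -/
instance decidableCoprimeDen {N : ℕ} (x y : Fin N → ℚ) (u : ℕ) : Decidable (CoprimeDen x y u) := by
  unfold CoprimeDen; infer_instance

/-- **Finite form of the Hodge-type test.** If `D ≥ 1` is a common multiple of all
`den x_j, den y_j, den (x_j+y_j), den x'_l, den y'_l, den (x'_l+y'_l)`, the test over all `u ≥ 1`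
is equivalent to the test over `u ∈ [1, D]` — decidable data (`decide +kernel` evaluates the
rational arithmetic). [folklore] -/
theorem hodgeCondition_iff_le {N N' k : ℕ} {x y : Fin N → ℚ} {x' y' : Fin N' → ℚ} {D : ℕ}
    (hD : 0 < D) (hx : ∀ j, (x j).den ∣ D) (hy : ∀ j, (y j).den ∣ D) (hxy : ∀ j, (x j + y j).den ∣ D)
    (hx' : ∀ l, (x' l).den ∣ D) (hy' : ∀ l, (y' l).den ∣ D) (hxy' : ∀ l, (x' l + y' l).den ∣ D) :
    HodgeCondition N N' k x y x' y' ↔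
      ∀ u ∈ Finset.Icc 1 D, CoprimeDen x y u → CoprimeDen x' y' u →
        hodgeSum x y u - hodgeSum x' y' u = (k : ℚ) := by
  constructor
  · exact fun h u hu hc hc' => h u (Finset.mem_Icc.mp hu).1 hc hc'
  · intro h u hu hc hc'
    -- reduce `u` to `u₀ = (u - 1) % D + 1 ∈ [1, D]`, `u = u₀ + D * t`
    set u₀ := (u - 1) % D + 1 with hu₀
    have hu₀pos : 0 < u₀ := Nat.succ_pos _
    have hu₀le : u₀ ≤ D := Nat.mod_lt _ hD
    obtain ⟨t, ht⟩ : ∃ t, u = u₀ + D * t := by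
      refine ⟨(u - 1) / D, ?_⟩
      have := Nat.mod_add_div (u - 1) D
      omega
    rw [ht] at hc hc' ⊢
    rw [coprimeDen_add_mul hx hy] at hc
    rw [coprimeDen_add_mul hx' hy'] at hc'
    rw [hodgeSum_add_mul hx hy hxy, hodgeSum_add_mul hx' hy' hxy']
    exact h u₀ (Finset.mem_Icc.mpr ⟨hu₀pos, hu₀le⟩) hc hc'

end FiniteTest

end Summit.KontsevichZagierPeriods.GammaHodgeSectorNegative
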